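import Literature.Computability.AlgebraicComplexity.ConstrainedMatMulSandwich
import HarnessLib

/-!
# Constrained matrix multiplication on a coordinate subspace: the tensor `T_S` (Wang 2026, §3.2)

Topic `Literature/Computability/AlgebraicComplexity`. PROVED, no named facts, no new definitions.

Wang 2026 (§3.2) constrains the first argument `X ∈ k^{c×m}` of `⟨c,m,n⟩` to a subspace `S` and
works with "the smaller tensor `T_S`", `R(T) ≥ R(T_S)` (Lemma 1).  The tree records certified lower
bounds for `T_S` in the language of bilinear computations on `S × k^{m×n}`
(`BilinComp ((mulBilin k c m n).comp S.subtype)`; `ConstrainedMatMulSandwich.lean`, and the `Cert`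
predicate of the `GF(2)` orbit sweeps), whereas substitution arguments in coordinates
(`HopcroftKerrRowLemma.lean`, `HopcroftKerrRowRestricted.lean`) consume `tensorRank` bounds for the
explicit **coordinate tensor** `(a, b', c') ↦ ⟨c,m,n⟩_{a b' c'}` with `b'` running over a coordinate
pattern `P ⊆ [c] × [m]` — which is `T_S` for the coordinate subspace `S_P = span {E_b : b ∈ P}`
written in the basis `(E_b)_{b ∈ P}`.  This file is the bridge from the first language to the second:

* `mul_apply_eq_sum_restrict` — for `X` supported on `P`,
  `(XY)_{pq} = ∑_{b' ∈ P} ∑_{c'} ⟨c,m,n⟩_{(p,q) b' c'} X_{b'} Y_{c'}`: the coordinate tensor computes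
  the constrained bilinear map (Wang 2026, §3.2);
* `le_tensorRank_restrict_of_forall_constrained` — if every `X ∈ S` is supported on `P` and every
  bilinear computation of `XY` on `S × k^{m×n}` has at least `b` products, then `b ≤ R(T_P)`:
  a triad decomposition of `T_P` of length `r` is read as a computation of length `r` on `S`
  (exactly as `bilinCompOfTriads` reads a decomposition of `⟨c,m,n⟩`, Bläser 2003, Def. 1);
* `le_tensorRank_matMulTensor333_delete00_of_forall_constrained`,
  `le_tensorRank_matMulTensor233_delete00_of_forall_constrained` — the instances with the entry
  `X₀₀` deleted (the tensors of `HopcroftKerrRowRestricted.lean`), for any `S ⊆ {X : X₀₀ = 0}`.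

A consumer holding a certificate `∀ r, BilinComp (ψ_K) (Fin r) → b ≤ r` for a list `K` of
single-entry constraint forms obtains `b ≤ tensorRank` of the corresponding coordinate tensor in one
line (the support hypothesis is membership in the kernels of the coordinate forms).

## References

* C. Wang, *Automated Lower Bounds for Bilinear Complexity over Finite Fields*, arXiv:2603.07280
  (2026), §3.2 (constraint subspaces, the tensor `T_S`), Lemma 1. [Wang2026]
* M. Bläser, *On the complexity of the multiplication of matrices of small formats*,
  J. Complexity 19 (2003) 43–60, Def. 1 (bilinear computations). [Blaser2003]
-/

namespace Literature.Computability.AlgebraicComplexity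

open Module Matrix

variable {k : Type*} [Field k] {c m n : ℕ}

/-- For a matrix `X` supported on the coordinate pattern `P`, the coordinate tensor of `⟨c,m,n⟩`
restricted to `P` computes `XY`:
`(XY)_{pq} = ∑_{b' : P b'} ∑_{c'} ⟨c,m,n⟩_{(p,q) b' c'} X_{b'} Y_{c'}`.
[cite: Wang2026, §3.2 (the tensor `T_S`)] -/
theorem mul_apply_eq_sum_restrict (P : Fin c × Fin m → Prop) [DecidablePred P]
    (x : Matrix (Fin c) (Fin m) k)
    (hx : ∀ i j, ¬ P (i, j) → x i j = 0) (y : Matrix (Fin m) (Fin n) k) (p : Fin c) (q : Fin n) :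
    (x * y) p q = ∑ b' : {b' : Fin c × Fin m // P b'}, ∑ c' : Fin m × Fin n,
      matMulTensor k c m n (p, q) b'.1 c' * x b'.1.1 b'.1.2 * y c'.1 c'.2 := by
  classical
  -- the unrestricted double sum is `(XY)_{pq}`
  have full : (x * y) p q = ∑ b : Fin c × Fin m, ∑ c' : Fin m × Fin n,
      matMulTensor k c m n (p, q) b c' * x b.1 b.2 * y c'.1 c'.2 := by
    rw [Matrix.mul_apply, Fintype.sum_prod_type]
    simp only [matMulTensor]
    rw [Finset.sum_eq_single p (fun b _ hb => by simp [Ne.symm hb]) (by simp)]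
    refine Finset.sum_congr rfl fun μ _ => ?_
    rw [Fintype.sum_prod_type]
    rw [Finset.sum_eq_single μ (fun b _ hb => by simp [Ne.symm hb]) (by simp)]
    rw [Finset.sum_eq_single q (fun b _ hb => by simp [Ne.symm hb]) (by simp)]
    simp
  rw [full, ← Finset.sum_subtype (Finset.univ.filter P) (by simp)
    (fun b : Fin c × Fin m => ∑ c' : Fin m × Fin n,
      matMulTensor k c m n (p, q) b c' * x b.1 b.2 * y c'.1 c'.2)]
  -- the terms off the pattern vanish because `x` is supported on `P`
  rw [Finset.sum_filter_of_ne]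
  intro b _ hb
  by_contra hP
  apply hb
  have hx0 : x b.1 b.2 = 0 := hx b.1 b.2 hP
  simp [hx0]

/-- **From constrained computations to the rank of the coordinate tensor** (Wang 2026, §3.2 with
Bläser 2003, Def. 1): if every `X ∈ S` is supported on the coordinate pattern `P` and every bilinear
computation of `(X, Y) ↦ XY` on `S × k^{m×n}` has at least `b` products, then `b ≤ R(T_P)` for the
coordinate tensor `T_P = (⟨c,m,n⟩_{a b' c'})_{a, b' ∈ P, c'}` — a decomposition of `T_P` into `r`
triads `w_i ⊗ u_i ⊗ v_i` is the computation `f_i(X) = ∑_{b' ∈ P} (u_i)_{b'} X_{b'}`,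
`g_i(Y) = ∑_{c'} (v_i)_{c'} Y_{c'}`, `w_i` of length `r` on `S`.
[cite: Wang2026, §3.2 and Lemma 1; Blaser2003, Def. 1] -/
theorem le_tensorRank_restrict_of_forall_constrained {b : ℕ} (P : Fin c × Fin m → Prop)
    [DecidablePred P] (S : Submodule k (Matrix (Fin c) (Fin m) k)) (hS : ∀ x ∈ S, ∀ i j, ¬ P (i, j) → x i j = 0)
    (h : ∀ r, BilinComp ((mulBilin k c m n).comp S.subtype) (Fin r) → b ≤ r) :
    b ≤ tensorRank (fun a (b' : {b' : Fin c × Fin m // P b'}) c' => matMulTensor k c m n a b'.1 c') := by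
  classical
  obtain ⟨w, u, v, ht⟩ := exists_triad_decomposition_tensorRank
    (fun a (b' : {b' : Fin c × Fin m // P b'}) c' => matMulTensor k c m n a b'.1 c')
  -- entries of the coordinate tensor from the decomposition
  have key : ∀ (p : Fin c) (q : Fin n) (b' : {b' : Fin c × Fin m // P b'}) (c' : Fin m × Fin n),
      matMulTensor k c m n (p, q) b'.1 c' = ∑ i, w i (p, q) * u i b' * v i c' := by
    intro p q b' c'
    have e := congrFun (congrFun (congrFun ht (p, q)) b') c'
    simpa [Finset.sum_apply, triad_apply] using e
  refine h _
    { f := fun i =>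
        ({ toFun := fun x => ∑ b' : {b' : Fin c × Fin m // P b'}, u i b' * x b'.1.1 b'.1.2
           map_add' := fun x y => by simp [Finset.sum_add_distrib, mul_add]
           map_smul' := fun a x => by simp [Finset.mul_sum, mul_left_comm] } :
          Matrix (Fin c) (Fin m) k →ₗ[k] k).comp S.subtype
      g := fun i =>
        { toFun := fun y => ∑ c' : Fin m × Fin n, v i c' * y c'.1 c'.2
          map_add' := fun x y => by simp [Finset.sum_add_distrib, mul_add]
          map_smul' := fun a x => by simp [Finset.mul_sum, mul_left_comm] }
      w := fun i => Matrix.of fun p q => w i (p, q)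
      map_eq_sum := fun x y => ?_ }
  rw [LinearMap.comp_apply, Submodule.subtype_apply, mulBilin_apply]
  ext p q
  rw [mul_apply_eq_sum_restrict P _ (hS _ x.2) y p q, Matrix.sum_apply]
  simp only [Matrix.smul_apply, Matrix.of_apply, LinearMap.coe_comp, Function.comp_apply,
    Submodule.subtype_apply, LinearMap.coe_mk, AddHom.coe_mk, smul_eq_mul]
  calc ∑ b' : {b' : Fin c × Fin m // P b'}, ∑ c' : Fin m × Fin n,
        matMulTensor k c m n (p, q) b'.1 c' * (x : Matrix (Fin c) (Fin m) k) b'.1.1 b'.1.2 * y c'.1 c'.2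
      = ∑ b' : {b' : Fin c × Fin m // P b'}, ∑ c' : Fin m × Fin n, ∑ i,
          w i (p, q) * u i b' * v i c' * (x : Matrix (Fin c) (Fin m) k) b'.1.1 b'.1.2 * y c'.1 c'.2 := by
        simp_rw [key, Finset.sum_mul]
    _ = ∑ i, ∑ b' : {b' : Fin c × Fin m // P b'}, ∑ c' : Fin m × Fin n,
          w i (p, q) * u i b' * v i c' * (x : Matrix (Fin c) (Fin m) k) b'.1.1 b'.1.2 * y c'.1 c'.2 := by
        trans ∑ b' : {b' : Fin c × Fin m // P b'}, ∑ i, ∑ c' : Fin m × Fin n,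
          w i (p, q) * u i b' * v i c' * (x : Matrix (Fin c) (Fin m) k) b'.1.1 b'.1.2 * y c'.1 c'.2
        · exact Finset.sum_congr rfl fun b' _ => Finset.sum_comm
        · exact Finset.sum_comm
    _ = ∑ i, (∑ b' : {b' : Fin c × Fin m // P b'}, u i b' * (x : Matrix (Fin c) (Fin m) k) b'.1.1 b'.1.2) *
          (∑ c' : Fin m × Fin n, v i c' * y c'.1 c'.2) * w i (p, q) := by
        refine Finset.sum_congr rfl fun i _ => ?_
        rw [Finset.sum_mul_sum, Finset.sum_mul]
        refine Finset.sum_congr rfl fun b' _ => ?_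
        rw [Finset.sum_mul]
        refine Finset.sum_congr rfl fun c' _ => ?_
        ring

/-- The instance `⟨3,3,3⟩` with the entry `X₀₀` deleted (the tensor `T_S`, `S = {X : X₀₀ = 0}`, of
`HopcroftKerrRowRestricted.lean`): a certificate "every computation of `XY` on `S' × k^{3×3}` has
`≥ b` products" for any `S' ⊆ {X₀₀ = 0}` gives `b ≤ R` of the coordinate tensor.
[cite: Wang2026, §3.2 and Lemma 1] -/
theorem le_tensorRank_matMulTensor333_delete00_of_forall_constrained {b : ℕ}
    (S : Submodule k (Matrix (Fin 3) (Fin 3) k)) (hS : ∀ x ∈ S, x 0 0 = 0)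
    (h : ∀ r, BilinComp ((mulBilin k 3 3 3).comp S.subtype) (Fin r) → b ≤ r) :
    b ≤ tensorRank (fun a (b' : {b' : Fin 3 × Fin 3 // b' ≠ (0, 0)}) c' =>
      matMulTensor k 3 3 3 a b'.1 c') :=
  le_tensorRank_restrict_of_forall_constrained (fun b' => b' ≠ (0, 0)) S
    (fun x hx i j hij => by
      have hij' := not_not.mp hij
      simp only [Prod.mk.injEq] at hij'
      obtain ⟨rfl, rfl⟩ := hij'
      exact hS x hx) h

/-- The instance `⟨2,3,3⟩` with the entry `X₀₀` deleted (the tensor whose rank enters the full-row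
caps of `HopcroftKerrRowRestricted.lean`): a certificate for any `S' ⊆ {X₀₀ = 0}` gives `b ≤ R` of
the coordinate tensor. [cite: Wang2026, §3.2 and Lemma 1] -/
theorem le_tensorRank_matMulTensor233_delete00_of_forall_constrained {b : ℕ}
    (S : Submodule k (Matrix (Fin 2) (Fin 3) k)) (hS : ∀ x ∈ S, x 0 0 = 0)
    (h : ∀ r, BilinComp ((mulBilin k 2 3 3).comp S.subtype) (Fin r) → b ≤ r) :
    b ≤ tensorRank (fun a (b' : {b' : Fin 2 × Fin 3 // b' ≠ (0, 0)}) c' =>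
      matMulTensor k 2 3 3 a b'.1 c') :=
  le_tensorRank_restrict_of_forall_constrained (fun b' => b' ≠ (0, 0)) S
    (fun x hx i j hij => by
      have hij' := not_not.mp hij
      simp only [Prod.mk.injEq] at hij'
      obtain ⟨rfl, rfl⟩ := hij'
      exact hS x hx) h

end Literature.Computability.AlgebraicComplexity
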